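import Mathlib
import Summits.AtomisticToContinuum.HydrodynamicLimit.Theorems.InformationPercolationEngineKickFairRelEquilibriumMesoCountExcessLGConst
import HarnessLib

/-!
# `KickFairRelEquilibriumMeso`, ALT line `kinetic-window-cut` — the DIAGONAL part of CP (`ClosePairCount`)
# at constant profiles is a first moment, paid by the landed CT-a at rung 0 (`countExcessLG_const`)

Scratch support (worker W4-2, wave 4; NOT a registered name): the close-pair statistic of `ClosePairCount`
contains the diagonal `(i,n) = (i',n')` (`PairClose p p i i` always holds), whose contribution is
`(N+1)^{1/3} (ε/(N+1))² Σ_i cnt_i`. Pointwise, for `A ≥ 0`,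
`cnt_i ≤ A (N+1)^{1/3} + (cnt_i − A (N+1)^{1/3})₊`, `(N+1)^{1/3} · ε/(N+1) = σ/(N+1) ≤ 1` and
`(N+1)^{2/3} (ε/(N+1))² (N+1) A = σ² A/(N+1)`, so the diagonal is at most `σ² A/(N+1) + (ε/(N+1)) Σ_i (cnt_i − A(N+1)^{1/3})₊`
(`diag_pointwise_le`), and its mean under the constant-profile local Gibbs law is `≤ δ` eventually
(`closePairCount_diag_const`, from `countExcessLG_const` at `δ/2`).
-/

noncomputable section

open MeasureTheory Set Filter Topology
open scoped ENNReal Classical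

namespace Summit.AtomisticToContinuum.HydrodynamicLimit.Theorems.KickFairRelEquilibriumMesoLine

open Literature.Analysis.FluidPDE Literature.MathematicalPhysics.KineticTheory

/-- **Pointwise bookkeeping of the diagonal.** For `0 < σ ≤ 1`, any `A` and any counts `c_i`,
`(N+1)^{1/3} (ε/(N+1))² Σ_i c_i ≤ σ² A/(N+1) + (ε/(N+1)) Σ_i (c_i − A (N+1)^{1/3})₊`. [folklore] -/
theorem diag_pointwise_le {N : ℕ} {σ : ℝ} (A : ℝ) (hσ : 0 < σ) (hσ1 : σ ≤ 1) (c : Fin (N + 1) → ℕ) :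
    ((N : ℝ) + 1) ^ (1 / 3 : ℝ) * (hsDiameter σ N / ((N : ℝ) + 1)) ^ 2 * ∑ i : Fin (N + 1), (c i : ℝ) ≤
      σ ^ 2 * A / ((N : ℝ) + 1) +
        hsDiameter σ N / ((N : ℝ) + 1) * ∑ i : Fin (N + 1), max ((c i : ℝ) - A * ((N : ℝ) + 1) ^ (1 / 3 : ℝ)) 0 := by
  set x : ℝ := (N : ℝ) + 1 with hx
  have hx0 : 0 < x := by positivity
  have hx1 : 1 ≤ x := by simp [hx]
  set P : ℝ := x ^ (1 / 3 : ℝ) with hP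
  have hP0 : 0 < P := Real.rpow_pos_of_pos hx0 _
  have hε : hsDiameter σ N = σ * P⁻¹ := by
    rw [hsDiameter, hP, Nat.cast_succ, Real.rpow_neg hx0.le]
  set e : ℝ := hsDiameter σ N / x with he
  have he0 : 0 ≤ e := by rw [he, hε]; positivity
  -- `P e = σ / x ≤ 1`
  have hPe : P * e = σ / x := by
    rw [he, hε]; field_simp
  have hPe1 : P * e ≤ 1 := by
    rw [hPe, div_le_one hx0]; exact hσ1.trans hx1
  -- `Σ c_i ≤ x A P + Σ (c_i − A P)₊`
  have hsum : ∑ i : Fin (N + 1), (c i : ℝ) ≤ x * (A * P) + ∑ i : Fin (N + 1), max ((c i : ℝ) - A * P) 0 := by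
    have h1 : ∀ i : Fin (N + 1), (c i : ℝ) ≤ A * P + max ((c i : ℝ) - A * P) 0 := fun i => by
      have := le_max_left ((c i : ℝ) - A * P) 0
      linarith
    calc ∑ i : Fin (N + 1), (c i : ℝ) ≤ ∑ i : Fin (N + 1), (A * P + max ((c i : ℝ) - A * P) 0) :=
          Finset.sum_le_sum fun i _ => h1 i
      _ = x * (A * P) + ∑ i : Fin (N + 1), max ((c i : ℝ) - A * P) 0 := by
          rw [Finset.sum_add_distrib, Finset.sum_const, Finset.card_univ, Fintype.card_fin, nsmul_eq_mul, hx]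
          push_cast
          ring
  have hS0 : 0 ≤ ∑ i : Fin (N + 1), max ((c i : ℝ) - A * P) 0 :=
    Finset.sum_nonneg fun i _ => le_max_right _ _
  have hPe2 : 0 ≤ P * e ^ 2 := by positivity
  calc P * e ^ 2 * ∑ i : Fin (N + 1), (c i : ℝ)
      ≤ P * e ^ 2 * (x * (A * P) + ∑ i : Fin (N + 1), max ((c i : ℝ) - A * P) 0) :=
        mul_le_mul_of_nonneg_left hsum hPe2
    _ = (P * e) ^ 2 * x * A + (P * e) * (e * ∑ i : Fin (N + 1), max ((c i : ℝ) - A * P) 0) := by ring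
    _ ≤ (σ / x) ^ 2 * x * A + 1 * (e * ∑ i : Fin (N + 1), max ((c i : ℝ) - A * P) 0) := by
        refine add_le_add (by rw [hPe]) ?_
        exact mul_le_mul_of_nonneg_right hPe1 (mul_nonneg he0 hS0)
    _ = σ ^ 2 * A / x + e * ∑ i : Fin (N + 1), max ((c i : ℝ) - A * P) 0 := by
        field_simp

/-- **The diagonal of CP at constant profiles (first moment).** For constant profiles `a, θ > 0`, `u` there is
`σ₀ > 0` such that for `0 < σ < σ₀`, every family of flows, `τ > 0`, `δ > 0`, eventually in `N`:
`E[(N+1)^{1/3} (ε/(N+1))² Σ_i cnt_i] ≤ δ` under the local Gibbs law with constant profiles — from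
`countExcessLG_const` at `δ/2` (`diag_pointwise_le`; the constant term `σ² A/(N+1) ≤ δ/2` for `N` large).
[folklore] -/
theorem closePairCount_diag_const : ∀ (a θ : ℝ) (u : V3), 0 < a → 0 < θ → ∃ σ₀ : ℝ, 0 < σ₀ ∧
    ∀ σ : ℝ, 0 < σ → σ < σ₀ → ∀ Φ : (N : ℕ) → Flow σ N, ∀ τ : ℝ, 0 < τ → ∀ δ : ℝ, 0 < δ → ∃ N₀ : ℕ,
    ∀ N : ℕ, N₀ ≤ N →
    ∫⁻ z, ENNReal.ofReal (((N : ℝ) + 1) ^ (1 / 3 : ℝ) * (hsDiameter σ N / ((N : ℝ) + 1)) ^ 2 *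
        ∑ i : Fin (N + 1), (cnt (Φ N) τ z i : ℝ))
      ∂(localGibbsLaw σ (fun _ => a) (fun _ => u) (fun _ => θ) N (Φ N)) ≤ ENNReal.ofReal δ := by
  intro a θ u ha hθ
  obtain ⟨σ₁, hσ₁, H⟩ := countExcessLG_const a θ u ha hθ
  refine ⟨min σ₁ (1 / 2), lt_min hσ₁ (by norm_num), fun σ hσ hσlt Φ τ hτ δ hδ => ?_⟩
  have hσ₁lt : σ < σ₁ := hσlt.trans_le (min_le_left _ _)
  have hσ2 : σ ≤ 1 / 2 := (hσlt.trans_le (min_le_right _ _)).le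
  have hσ1 : σ ≤ 1 := by linarith
  obtain ⟨A, hA, N₁, hN₁⟩ := H σ hσ hσ₁lt Φ τ hτ (δ / 2) (by positivity)
  obtain ⟨N₂, hN₂⟩ := exists_nat_gt (2 * σ ^ 2 * A / δ)
  refine ⟨max N₁ N₂, fun N hN => ?_⟩
  have hN1 : N₁ ≤ N := (le_max_left _ _).trans hN
  have hN2 : (N₂ : ℝ) ≤ (N : ℝ) := by exact_mod_cast (le_max_right _ _).trans hN
  have hx0 : (0 : ℝ) < (N : ℝ) + 1 := by positivity
  set μ := localGibbsLaw σ (fun _ => a) (fun _ => u) (fun _ => θ) N (Φ N) with hμ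
  haveI : IsProbabilityMeasure μ :=
    isProbabilityMeasure_localGibbsLaw continuous_const continuous_const continuous_const
      (fun _ => ha) (fun _ => hθ) hσ2 N (Φ N)
  -- the constant term
  have hconst : σ ^ 2 * A / ((N : ℝ) + 1) ≤ δ / 2 := by
    rw [div_le_iff₀ hx0]
    have h1 : 2 * σ ^ 2 * A / δ < (N : ℝ) + 1 := by linarith
    rw [div_lt_iff₀ hδ] at h1
    linarith
  have hc0 : 0 ≤ σ ^ 2 * A / ((N : ℝ) + 1) := by positivity
  calc ∫⁻ z, ENNReal.ofReal (((N : ℝ) + 1) ^ (1 / 3 : ℝ) * (hsDiameter σ N / ((N : ℝ) + 1)) ^ 2 *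
          ∑ i : Fin (N + 1), (cnt (Φ N) τ z i : ℝ)) ∂μ
      ≤ ∫⁻ z, (ENNReal.ofReal (σ ^ 2 * A / ((N : ℝ) + 1)) + ENNReal.ofReal (hsDiameter σ N / ((N : ℝ) + 1) *
          ∑ i : Fin (N + 1), max ((cnt (Φ N) τ z i : ℝ) - A * ((N : ℝ) + 1) ^ (1 / 3 : ℝ)) 0)) ∂μ := by
        refine lintegral_mono fun z => ?_
        rw [← ENNReal.ofReal_add hc0 (mul_nonneg (by have := hsDiameter_pos hσ N; positivity)
          (Finset.sum_nonneg fun i _ => le_max_right _ _))]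
        exact ENNReal.ofReal_le_ofReal (diag_pointwise_le A hσ hσ1 _)
    _ = ENNReal.ofReal (σ ^ 2 * A / ((N : ℝ) + 1)) * μ univ + ∫⁻ z, ENNReal.ofReal (hsDiameter σ N / ((N : ℝ) + 1) *
          ∑ i : Fin (N + 1), max ((cnt (Φ N) τ z i : ℝ) - A * ((N : ℝ) + 1) ^ (1 / 3 : ℝ)) 0) ∂μ := by
        rw [lintegral_add_left measurable_const, lintegral_const]
    _ ≤ ENNReal.ofReal (δ / 2) + ENNReal.ofReal (δ / 2) := by
        rw [measure_univ, mul_one]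
        exact add_le_add (ENNReal.ofReal_le_ofReal hconst) (hN₁ N hN1)
    _ = ENNReal.ofReal δ := by
        rw [← ENNReal.ofReal_add (by positivity) (by positivity), add_halves]

end Summit.AtomisticToContinuum.HydrodynamicLimit.Theorems.KickFairRelEquilibriumMesoLine

end
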